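import Mathlib
import Summits.ValiantsHypothesis.ValiantsHypothesis.Theses.LiouvilleSarnak
import HarnessLib

/-!
# Route LiouvilleSarnak — crux `LiouvilleCutRank` (stmt-ValiantsHypothesis-14775): the DYADIC SHADOW IS NOT ENOUGH
# (a barrier lemma for the window method)

Every unconditional result toward the crux in the tree (`Theorems/LiouvilleSarnakCutRank*.lean`,
`…LiouvilleCutRank*.lean`) moves around the cut matrix `M_π(r,c) = λ(N_π(r,c) + 1)` with ONE arithmetic identity,
`λ(2x) = -λ(x)` (window transfer: bits below a window set to `1`, `λ(2^s x) = (-1)^s λ(x)`), plus a finite table or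
Coons' non-automaticity.  This file records, as a theorem, that the dyadic identity BY ITSELF carries no rank
information at all: there is a `±1`-valued `g : ℕ → ℤ` with `g(2m) = -g(m)` for all `m ≥ 1`, agreeing with `λ` on
`[1, 6]`, such that EVERY cut matrix `(g(N_π(r,c) + 1))_{r,c}` — every level `n`, every cut `π`, balanced or not — has
rank `≤ 1`.  The witness is the Thue–Morse sign `g(m) = (-1)^{s₂(m-1)}` (`s₂` = binary digit sum): `s₂(2m-1) =
s₂(m-1) + 1`, and `(-1)^{s₂(N)}` is a product of one factor per bit, so every cut matrix is an outer product.

* `exists_dyadic_shadow_rank_le_one` — ★ the barrier statement above.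

Consequence for planning (honest framing): any line toward `LiouvilleCutRank` must use an input that `(-1)^{s₂(m-1)}`
violates — multiplicativity at an odd prime (`λ(3m) = -λ(m)` fails for the witness at `m = 3`: `g(9) = -1`),
non-automaticity (the witness IS `2`-automatic; cf. the aligned rung via Coons), or analytic information.  Nothing here
is a case of the crux; `LiouvilleCutRank`, `DigitalBilinearLiouville`, `AlgebraicSarnak` stay OPEN; nothing bears on
`VP ≠ VNP`.  No definitions (the witness is the explicit term `Nat.binaryRec 1 (fun b _ t => cond b (-t) t)`).
-/

set_option linter.dupNamespace false

noncomputable section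

namespace Summit.ValiantsHypothesis.ValiantsHypothesis.Theorems.LiouvilleSarnakLiouvilleCutRank.DyadicBarrier

open ArithmeticFunction Finset

/-! ### §1 The Thue–Morse sign `T(N) = (-1)^{s₂(N)}` as a binary recursion -/

/-- `T(bit b n) = ∓ T(n)`: appending a low bit flips the sign iff the bit is `1`. [folklore] -/
theorem tm_bit (b : Bool) (n : ℕ) :
    Nat.binaryRec (motive := fun _ => ℤ) (1 : ℤ) (fun b _ t => cond b (-t) t) (Nat.bit b n) =
      cond b (-(Nat.binaryRec (motive := fun _ => ℤ) (1 : ℤ) (fun b _ t => cond b (-t) t) n))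
        (Nat.binaryRec (motive := fun _ => ℤ) (1 : ℤ) (fun b _ t => cond b (-t) t) n) :=
  Nat.binaryRec_eq (motive := fun _ => ℤ) b n (Or.inl rfl)

/-- `T(N) ∈ {1, -1}`. [folklore] -/
theorem tm_eq_one_or (N : ℕ) :
    Nat.binaryRec (motive := fun _ => ℤ) (1 : ℤ) (fun b _ t => cond b (-t) t) N = 1 ∨
      Nat.binaryRec (motive := fun _ => ℤ) (1 : ℤ) (fun b _ t => cond b (-t) t) N = -1 := by
  induction N using Nat.binaryRec with
  | zero => left; rfl
  | bit b n ih =>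
    rw [tm_bit]
    cases b
    · simpa using ih
    · rcases ih with h | h
      · right; simp [h]
      · left; simp [h]

/-- `T(ofBits f) = ∏_j (f j ? -1 : 1)`: the Thue–Morse sign of a bit vector is the product of one sign per bit.
[folklore] -/
theorem tm_ofBits {k : ℕ} (f : Fin k → Bool) :
    Nat.binaryRec (motive := fun _ => ℤ) (1 : ℤ) (fun b _ t => cond b (-t) t) (Nat.ofBits f) =
      ∏ j : Fin k, (cond (f j) (-1 : ℤ) 1) := by
  induction k with
  | zero => simp
  | succ k ih =>
    have hbit : Nat.ofBits f = Nat.bit (f 0) (Nat.ofBits (f ∘ Fin.succ)) := by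
      rw [Nat.ofBits_succ, Nat.bit_val]
    rw [hbit, tm_bit, ih, Fin.prod_univ_succ]
    cases f 0 <;> simp

/-- The first six Thue–Morse signs: `T(0..5) = 1, -1, -1, 1, -1, 1`. [folklore] -/
theorem tm_small :
    Nat.binaryRec (motive := fun _ => ℤ) (1 : ℤ) (fun b _ t => cond b (-t) t) 0 = 1 ∧
    Nat.binaryRec (motive := fun _ => ℤ) (1 : ℤ) (fun b _ t => cond b (-t) t) 1 = -1 ∧
    Nat.binaryRec (motive := fun _ => ℤ) (1 : ℤ) (fun b _ t => cond b (-t) t) 2 = -1 ∧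
    Nat.binaryRec (motive := fun _ => ℤ) (1 : ℤ) (fun b _ t => cond b (-t) t) 3 = 1 ∧
    Nat.binaryRec (motive := fun _ => ℤ) (1 : ℤ) (fun b _ t => cond b (-t) t) 4 = -1 ∧
    Nat.binaryRec (motive := fun _ => ℤ) (1 : ℤ) (fun b _ t => cond b (-t) t) 5 = 1 := by
  have h0 : Nat.binaryRec (motive := fun _ => ℤ) (1 : ℤ) (fun b _ t => cond b (-t) t) 0 = 1 := rfl
  have h1 : Nat.binaryRec (motive := fun _ => ℤ) (1 : ℤ) (fun b _ t => cond b (-t) t) 1 = -1 := by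
    have := tm_bit true 0
    rw [show Nat.bit true 0 = 1 from rfl, h0] at this
    simp
  have h2 : Nat.binaryRec (motive := fun _ => ℤ) (1 : ℤ) (fun b _ t => cond b (-t) t) 2 = -1 := by
    have := tm_bit false 1
    rw [show Nat.bit false 1 = 2 from rfl, h1] at this
    simpa using this
  have h3 : Nat.binaryRec (motive := fun _ => ℤ) (1 : ℤ) (fun b _ t => cond b (-t) t) 3 = 1 := by
    have := tm_bit true 1
    rw [show Nat.bit true 1 = 3 from rfl, h1] at this
    simpa using this
  have h4 : Nat.binaryRec (motive := fun _ => ℤ) (1 : ℤ) (fun b _ t => cond b (-t) t) 4 = -1 := by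
    have := tm_bit false 2
    rw [show Nat.bit false 2 = 4 from rfl, h2] at this
    simpa using this
  have h5 : Nat.binaryRec (motive := fun _ => ℤ) (1 : ℤ) (fun b _ t => cond b (-t) t) 5 = 1 := by
    have := tm_bit true 2
    rw [show Nat.bit true 2 = 5 from rfl, h2] at this
    simpa using this
  exact ⟨h0, h1, h2, h3, h4, h5⟩

/-- `λ(1..6) = 1, -1, -1, 1, -1, 1`. [folklore] -/
theorem liouville_small :
    liouville 1 = 1 ∧ liouville 2 = -1 ∧ liouville 3 = -1 ∧ liouville 4 = 1 ∧ liouville 5 = -1 ∧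
      liouville 6 = 1 := by
  have hl1 : liouville 1 = 1 := by rw [liouville_apply one_ne_zero, cardFactors_one]; norm_num
  have hl2 : liouville 2 = -1 := by
    rw [liouville_apply two_ne_zero, cardFactors_apply_prime Nat.prime_two]; norm_num
  have hl3 : liouville 3 = -1 := by
    rw [liouville_apply (by norm_num), cardFactors_apply_prime Nat.prime_three]; norm_num
  have hl5 : liouville 5 = -1 := by
    rw [liouville_apply (by norm_num), cardFactors_apply_prime (by norm_num : Nat.Prime 5)]; norm_num
  have hl4 : liouville 4 = 1 := by
    rw [show (4 : ℕ) = 2 * 2 by norm_num, liouville_apply_mul, hl2]; norm_num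
  have hl6 : liouville 6 = 1 := by
    rw [show (6 : ℕ) = 2 * 3 by norm_num, liouville_apply_mul, hl2, hl3]; norm_num
  exact ⟨hl1, hl2, hl3, hl4, hl5, hl6⟩

/-! ### §2 The barrier -/

/-- ★ **The dyadic shadow is not enough.**  There is `g : ℕ → ℤ` with values in `{1, -1}`, with `g(2m) = -g(m)` for
every `m ≥ 1` (the only arithmetic of `λ` used by the window-transfer lemmas), agreeing with the Liouville function on
`1, …, 6`, such that for EVERY `n` and EVERY cut `π : Fin n ⊕ Fin n ≃ Fin 2n` the cut matrix `(g(N_π(r,c)+1))_{r,c}`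
has rank `≤ 1`.  Witness: `g(m) = (-1)^{s₂(m-1)}` (Thue–Morse sign), for which each cut matrix is the outer product of
`r ↦ (-1)^{#r}` and `c ↦ (-1)^{#c}`. [folklore] -/
theorem exists_dyadic_shadow_rank_le_one :
    ∃ g : ℕ → ℤ, (∀ m, g m = 1 ∨ g m = -1) ∧ (∀ m, 1 ≤ m → g (2 * m) = -g m) ∧
      (∀ m, 1 ≤ m → m ≤ 6 → g m = liouville m) ∧
      ∀ (n : ℕ) (π : Fin n ⊕ Fin n ≃ Fin (2 * n)),
        (Matrix.of fun r c : Fin n → Bool =>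
          ((g (Nat.ofBits (fun j : Fin (2 * n) => Sum.elim r c (π.symm j)) + 1) : ℤ) : ℂ)).rank ≤ 1 := by
  refine ⟨fun m => Nat.binaryRec (motive := fun _ => ℤ) (1 : ℤ) (fun b _ t => cond b (-t) t) (m - 1),
    fun m => tm_eq_one_or _, fun m hm => ?_, fun m hm hm6 => ?_, fun n π => ?_⟩
  · -- `2m - 1 = bit true (m - 1)`
    have h : 2 * m - 1 = Nat.bit true (m - 1) := by rw [Nat.bit_val]; simp; omega
    show Nat.binaryRec (motive := fun _ => ℤ) (1 : ℤ) (fun b _ t => cond b (-t) t) (2 * m - 1) =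
      -Nat.binaryRec (motive := fun _ => ℤ) (1 : ℤ) (fun b _ t => cond b (-t) t) (m - 1)
    rw [h]
    exact (tm_bit true (m - 1)).trans (by simp)
  · -- the six values
    obtain ⟨h0, h1, h2, h3, h4, h5⟩ := tm_small
    obtain ⟨hl1, hl2, hl3, hl4, hl5, hl6⟩ := liouville_small
    interval_cases m
    · simp [hl1]
    · simp [hl2]
    · simpa [hl3] using h2
    · simpa [hl4] using h3
    · simpa [hl5] using h4
    · simpa [hl6] using h5
  · -- every cut matrix is an outer product
    have hentry : ∀ r c : Fin n → Bool,
        Nat.binaryRec (motive := fun _ => ℤ) (1 : ℤ) (fun b _ t => cond b (-t) t)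
            (Nat.ofBits (fun j : Fin (2 * n) => Sum.elim r c (π.symm j)) + 1 - 1) =
          (∏ i : Fin n, (cond (r i) (-1 : ℤ) 1)) * ∏ i : Fin n, (cond (c i) (-1 : ℤ) 1) := by
      intro r c
      rw [Nat.add_sub_cancel, tm_ofBits]
      rw [show (∏ j : Fin (2 * n), cond (Sum.elim r c (π.symm j)) (-1 : ℤ) 1) =
          ∏ x : Fin n ⊕ Fin n, cond (Sum.elim r c x) (-1 : ℤ) 1 from
        Equiv.prod_comp π.symm (fun x => cond (Sum.elim r c x) (-1 : ℤ) 1)]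
      rw [Fintype.prod_sum_type]
      rfl
    have hM : (Matrix.of fun r c : Fin n → Bool =>
          ((Nat.binaryRec (motive := fun _ => ℤ) (1 : ℤ) (fun b _ t => cond b (-t) t)
            (Nat.ofBits (fun j : Fin (2 * n) => Sum.elim r c (π.symm j)) + 1 - 1) : ℤ) : ℂ)) =
        Matrix.vecMulVec (fun r : Fin n → Bool => ((∏ i : Fin n, (cond (r i) (-1 : ℤ) 1) : ℤ) : ℂ))
          (fun c : Fin n → Bool => ((∏ i : Fin n, (cond (c i) (-1 : ℤ) 1) : ℤ) : ℂ)) := by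
      ext r c
      rw [Matrix.of_apply, Matrix.vecMulVec_apply, hentry, Int.cast_mul]
    show (Matrix.of fun r c : Fin n → Bool =>
          ((Nat.binaryRec (motive := fun _ => ℤ) (1 : ℤ) (fun b _ t => cond b (-t) t)
            (Nat.ofBits (fun j : Fin (2 * n) => Sum.elim r c (π.symm j)) + 1 - 1) : ℤ) : ℂ)).rank ≤ 1
    rw [hM]
    exact Matrix.rank_vecMulVec_le _ _

end Summit.ValiantsHypothesis.ValiantsHypothesis.Theorems.LiouvilleSarnakLiouvilleCutRank.DyadicBarrier
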